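import Summits.QuantumFields.GaugeBoot.DiagonalRPTorusSignMonomials
import HarnessLib

/-!
# The plaquette graph of `(ℤ/L)³`: adjacency, stars, columns (gauge-boot, task L3(ν), 1/4)

HONEST FRAMING (cell `pub-gaugeboot`, page 1 of every file): the venture produces certified bounds
on lattice expectations at stated coupling, gauge group, dimension and torus size; NOT a mass gap,
NOT a continuum limit, NOT a string tension; NOT Yang–Mills-summit-bearing (barriers
`FixedCouplingUltralocality`, `PerturbativeInvisibility`). This module is pure bookkeeping for the
structural NEGATIVE results about torus diagonal reflection positivity built on it
(`DiagonalRPTorusPolymerBound` → `DiagonalRPTorusColumns` → `DiagonalRPTorusNegativeOdd`); it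
discharges nothing by itself.

## Content (general torus size `L`, dimension `3`)

* `padj p q` — two plaquettes share a link (reflexive, symmetric); `touches A B p` — `p` contains a
  link of the Polyakov loop over the column `A` or `B` (the seeds of the polymer split);
* `degS_symmDiff_add` — `deg_{S Δ Z} + 2 deg_{S ∩ Z} = deg_S + deg_Z`;
* `linkList`, `starList` and the counts: a plaquette has at most four links (`card_plinks_le`), a
  link lies in at most four plaquettes (`card_star_le`), hence a plaquette is adjacent to at most
  `16` plaquettes (`card_filter_padj_le`); a column has at most `L` links (`card_colLinks_le`) and
  at most `8 L` plaquettes touch two columns (`card_filter_touches_le`).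

Elementary; in the tree's torus vocabulary (`Site`, `Edge`, `Plaquette`, `Site.shift` of
`Literature.MathematicalPhysics.QuantumFieldTheory`).
-/

open MeasureTheory Complex Finset
open scoped ComplexOrder symmDiff

namespace Summit.QuantumFields.GaugeBoot

open Literature.MathematicalPhysics.QuantumFieldTheory

namespace DiagRPThree

/-! ## Plaquette adjacency (sharing a link); no finiteness needed -/

section Adjacency

variable {L : ℕ}

/-- `deg_{S Δ Z} + 2 deg_{S ∩ Z} = deg_S + deg_Z`, linkwise. -/
theorem degS_symmDiff_add (S Z : Finset (Plaquette 3 L)) (e : Edge 3 L) :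
    degS (S ∆ Z) e + 2 * degS (S ∩ Z) e = degS S e + degS Z e := by
  unfold degS
  have h1 : ∑ p ∈ S ∆ Z ∪ S ∩ Z, pcnt p e = ∑ p ∈ S ∆ Z, pcnt p e + ∑ p ∈ S ∩ Z, pcnt p e :=
    sum_union (disjoint_symmDiff_inf S Z)
  have h2 : S ∆ Z ∪ S ∩ Z = S ∪ Z := symmDiff_sup_inf S Z
  have h3 := sum_union_inter (s₁ := S) (s₂ := Z) (f := fun p => pcnt p e)
  rw [h2] at h1
  omega

/-- Two plaquettes are ADJACENT when they share a link. [shape] A parametric definition of a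
relation (reflexive and symmetric) — NOT a fact. -/
def padj (p q : Plaquette 3 L) : Prop := ∃ e : Edge 3 L, pcnt p e ≠ 0 ∧ pcnt q e ≠ 0

/-- The plaquette `p` TOUCHES the columns `A`, `B`: one of its links is a link of the Polyakov
loop over `A` or over `B`. [shape] A parametric definition of a predicate — NOT a fact. -/
def touches (A B : ZMod L × ZMod L) (p : Plaquette 3 L) : Prop :=
  ∃ e : Edge 3 L, pcnt p e ≠ 0 ∧ (ccnt A e ≠ 0 ∨ ccnt B e ≠ 0)

/-- A plaquette contains its first link. -/
theorem pcnt_self_ne_zero (p : Plaquette 3 L) : pcnt p (p.1, p.2.1.1) ≠ 0 := by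
  unfold pcnt
  rw [if_pos rfl]
  omega

/-- Adjacency is reflexive. -/
theorem padj_refl (p : Plaquette 3 L) : padj p p := ⟨_, pcnt_self_ne_zero p, pcnt_self_ne_zero p⟩

/-- Adjacency is symmetric. -/
theorem padj_symm {p q : Plaquette 3 L} (h : padj p q) : padj q p := by
  obtain ⟨e, h1, h2⟩ := h
  exact ⟨e, h2, h1⟩

/-- The four defining links of a plaquette, as a list. -/
def linkList (p : Plaquette 3 L) : List (Edge 3 L) :=
  [(p.1, p.2.1.1), (p.1.shift p.2.1.1, p.2.1.2), (p.1.shift p.2.1.2, p.2.1.1), (p.1, p.2.1.2)]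

/-- A link of `p` is one of its four defining links. -/
theorem mem_linkList_of_pcnt_ne_zero {p : Plaquette 3 L} {e : Edge 3 L} (h : pcnt p e ≠ 0) :
    e ∈ linkList p := by
  unfold pcnt at h
  unfold linkList
  simp only [List.mem_cons, List.not_mem_nil, or_false]
  by_contra hne
  simp only [not_or] at hne
  obtain ⟨h1, h2, h3, h4⟩ := hne
  rw [if_neg (Ne.symm h1), if_neg (Ne.symm h2), if_neg (Ne.symm h3), if_neg (Ne.symm h4)] at h
  exact h rfl

/-- The candidate plaquettes through a link `e = (y, k)` in the coordinate plane `pl`: none unless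
the plane contains the direction `k`; then the plaquettes of that plane based at `y` and at
`y - e_m`, `m` the other direction of the plane (a list of length two). -/
def starList (e : Edge 3 L) (pl : {q : Fin 3 × Fin 3 // q.1 < q.2}) : List (Plaquette 3 L) :=
  if pl.1.1 = e.2 then [(e.1, pl), (e.1 - Pi.single pl.1.2 1, pl)]
  else if pl.1.2 = e.2 then [(e.1, pl), (e.1 - Pi.single pl.1.1 1, pl)] else []

/-- A plaquette containing the link `e` is one of the (at most two) candidates of its own plane. -/
theorem mem_starList_of_pcnt_ne_zero {p : Plaquette 3 L} {e : Edge 3 L} (h : pcnt p e ≠ 0) :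
    p ∈ starList e p.2 := by
  obtain ⟨x, pl⟩ := p
  have hne : pl.1.1 ≠ pl.1.2 := ne_of_lt pl.2
  unfold pcnt at h
  unfold starList
  simp only
  by_cases h1 : (x, pl.1.1) = e
  · rw [if_pos (congrArg Prod.snd h1)]
    simp only [List.mem_cons, List.not_mem_nil, or_false, Prod.mk.injEq, and_true]
    exact Or.inl (congrArg Prod.fst h1)
  by_cases h3 : (x.shift pl.1.2, pl.1.1) = e
  · rw [if_pos (congrArg Prod.snd h3)]
    simp only [List.mem_cons, List.not_mem_nil, or_false, Prod.mk.injEq, and_true]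
    refine Or.inr ?_
    have h3' : x + Pi.single pl.1.2 1 = e.1 := congrArg Prod.fst h3
    rw [← h3', add_sub_cancel_right]
  by_cases h2 : (x.shift pl.1.1, pl.1.2) = e
  · have hk : pl.1.2 = e.2 := congrArg Prod.snd h2
    rw [if_neg (fun h => hne (h.trans hk.symm)), if_pos hk]
    simp only [List.mem_cons, List.not_mem_nil, or_false, Prod.mk.injEq, and_true]
    refine Or.inr ?_
    have h2' : x + Pi.single pl.1.1 1 = e.1 := congrArg Prod.fst h2
    rw [← h2', add_sub_cancel_right]
  by_cases h4 : (x, pl.1.2) = e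
  · have hk : pl.1.2 = e.2 := congrArg Prod.snd h4
    rw [if_neg (fun h => hne (h.trans hk.symm)), if_pos hk]
    simp only [List.mem_cons, List.not_mem_nil, or_false, Prod.mk.injEq, and_true]
    exact Or.inl (congrArg Prod.fst h4)
  rw [if_neg h1, if_neg h2, if_neg h3, if_neg h4] at h
  exact (h rfl).elim

/-- The candidate list has length two for the (two) planes through `e.2`, zero otherwise. -/
theorem length_starList_le (e : Edge 3 L) (pl : {q : Fin 3 × Fin 3 // q.1 < q.2}) :
    (starList e pl).length ≤ if pl.1.1 = e.2 ∨ pl.1.2 = e.2 then 2 else 0 := by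
  unfold starList
  split_ifs <;> simp_all

/-- Two of the three coordinate planes contain a given direction. -/
theorem sum_planes_ite (k : Fin 3) :
    ∑ pl : {q : Fin 3 × Fin 3 // q.1 < q.2}, (if pl.1.1 = k ∨ pl.1.2 = k then 2 else 0) = 4 := by
  fin_cases k <;> decide

end Adjacency

/-! ## Counting: links of a plaquette, plaquettes through a link, plaquettes at two columns -/

section Counting

variable {L : ℕ} [NeZero L]

/-- The links of a plaquette. -/
def plinks (p : Plaquette 3 L) : Finset (Edge 3 L) := univ.filter fun e => pcnt p e ≠ 0

/-- The plaquettes containing a link (its star). -/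
def star (e : Edge 3 L) : Finset (Plaquette 3 L) := univ.filter fun p => pcnt p e ≠ 0

/-- The links of the column `A` (the links of the Polyakov loop `P_A`). -/
def colLinks (A : ZMod L × ZMod L) : Finset (Edge 3 L) := univ.filter fun e => ccnt A e ≠ 0

/-- Membership in `plinks`. -/
theorem mem_plinks {p : Plaquette 3 L} {e : Edge 3 L} : e ∈ plinks p ↔ pcnt p e ≠ 0 := by
  simp [plinks]

/-- Membership in `star`. -/
theorem mem_star {p : Plaquette 3 L} {e : Edge 3 L} : p ∈ star e ↔ pcnt p e ≠ 0 := by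
  simp [star]

/-- Membership in `colLinks`. -/
theorem mem_colLinks {A : ZMod L × ZMod L} {e : Edge 3 L} : e ∈ colLinks A ↔ ccnt A e ≠ 0 := by
  simp [colLinks]

/-- A plaquette has at most four links. -/
theorem card_plinks_le (p : Plaquette 3 L) : (plinks p).card ≤ 4 := by
  have hsub : plinks p ⊆ (linkList p).toFinset := fun e he =>
    List.mem_toFinset.2 (mem_linkList_of_pcnt_ne_zero (mem_plinks.1 he))
  exact (card_le_card hsub).trans ((List.toFinset_card_le _).trans_eq rfl)

/-- A link lies in at most four plaquettes. -/
theorem card_star_le (e : Edge 3 L) : (star e).card ≤ 4 := by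
  have hsub : star e ⊆ (univ : Finset {q : Fin 3 × Fin 3 // q.1 < q.2}).biUnion
      fun pl => (starList e pl).toFinset := fun p hp =>
    mem_biUnion.2 ⟨p.2, mem_univ _,
      List.mem_toFinset.2 (mem_starList_of_pcnt_ne_zero (mem_star.1 hp))⟩
  refine (card_le_card hsub).trans (card_biUnion_le.trans ?_)
  calc ∑ pl : {q : Fin 3 × Fin 3 // q.1 < q.2}, ((starList e pl).toFinset).card
      ≤ ∑ pl : {q : Fin 3 × Fin 3 // q.1 < q.2}, (if pl.1.1 = e.2 ∨ pl.1.2 = e.2 then 2 else 0) :=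
        sum_le_sum fun pl _ => (List.toFinset_card_le _).trans (length_starList_le e pl)
    _ = 4 := sum_planes_ite e.2

/-- **Degree bound**: a plaquette is adjacent to at most `16` plaquettes (within any region). -/
theorem card_filter_padj_le [DecidableRel (padj (L := L))] (a : Plaquette 3 L)
    (P : Finset (Plaquette 3 L)) : (P.filter (padj a)).card ≤ 16 := by
  have hsub : P.filter (padj a) ⊆ (plinks a).biUnion star := by
    intro q hq
    obtain ⟨e, h1, h2⟩ := (mem_filter.1 hq).2
    exact mem_biUnion.2 ⟨e, mem_plinks.2 h1, mem_star.2 h2⟩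
  refine (card_le_card hsub).trans (card_biUnion_le.trans ?_)
  calc ∑ e ∈ plinks a, (star e).card ≤ ∑ _e ∈ plinks a, 4 := sum_le_sum fun e _ => card_star_le e
    _ = (plinks a).card * 4 := by rw [sum_const, smul_eq_mul]
    _ ≤ 4 * 4 := Nat.mul_le_mul_right _ (card_plinks_le a)

/-- A column has at most `L` links (in fact exactly one per height). -/
theorem card_colLinks_le (A : ZMod L × ZMod L) : (colLinks A).card ≤ L := by
  have h : Set.InjOn (fun e : Edge 3 L => e.1 2) (colLinks A) := by
    intro e he e' he' (hee : e.1 2 = e'.1 2)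
    obtain ⟨h2, h0, h1⟩ := ccnt_ne_zero (mem_colLinks.1 (mem_coe.1 he))
    obtain ⟨h2', h0', h1'⟩ := ccnt_ne_zero (mem_colLinks.1 (mem_coe.1 he'))
    refine Prod.ext (funext fun i => ?_) (h2.trans h2'.symm)
    fin_cases i
    · exact h0.trans h0'.symm
    · exact h1.trans h1'.symm
    · exact hee
  calc (colLinks A).card ≤ (univ : Finset (ZMod L)).card :=
        card_le_card_of_injOn (fun e => e.1 2) (fun _ _ => mem_coe.2 (mem_univ _)) h
    _ = L := by rw [card_univ, ZMod.card]

/-- At most `8 L` plaquettes touch two columns. -/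
theorem card_filter_touches_le (A B : ZMod L × ZMod L) [DecidablePred (touches A B)] :
    ((univ : Finset (Plaquette 3 L)).filter (touches A B)).card ≤ 8 * L := by
  have hsub : (univ : Finset (Plaquette 3 L)).filter (touches A B) ⊆
      (colLinks A ∪ colLinks B).biUnion star := by
    intro p hp
    obtain ⟨e, h1, h2⟩ := (mem_filter.1 hp).2
    refine mem_biUnion.2 ⟨e, ?_, mem_star.2 h1⟩
    rcases h2 with h2 | h2
    · exact mem_union_left _ (mem_colLinks.2 h2)
    · exact mem_union_right _ (mem_colLinks.2 h2)
  refine (card_le_card hsub).trans (card_biUnion_le.trans ?_)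
  calc ∑ e ∈ colLinks A ∪ colLinks B, (star e).card ≤ ∑ _e ∈ colLinks A ∪ colLinks B, 4 :=
        sum_le_sum fun e _ => card_star_le e
    _ = (colLinks A ∪ colLinks B).card * 4 := by rw [sum_const, smul_eq_mul]
    _ ≤ (L + L) * 4 := Nat.mul_le_mul_right _
        ((card_union_le _ _).trans (add_le_add (card_colLinks_le A) (card_colLinks_le B)))
    _ = 8 * L := by ring

end Counting

end DiagRPThree

end Summit.QuantumFields.GaugeBoot
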